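import Mathlib
import Summits.NavierStokesRegularity.NavierStokesRegularity.Theorems.LerayQuarterDissipationFiniteDissipationLiouvilleVorticityLThree
import Summits.NavierStokesRegularity.NavierStokesRegularity.Theorems.LerayQuarterDissipationFiniteDissipationLiouvilleVorticityAmplitudeRegion
import Summits.NavierStokesRegularity.NavierStokesRegularity.Theorems.LerayQuarterDissipationFiniteDissipationLiouvilleHardness
import HarnessLib

/-!
# Crux `FiniteDissipationLiouville` (stmt-NavierStokesRegularity-22144): the `L³`-vorticity rung and
# the `(K, C_ω)` hyperbola — LAW-FREE forms (enveloped Type-I ancient fields; the catalogued DSS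
# wall on the sub-class, every factor) and the proved region of the crux in `(C, K, C_ω, V₃)`

Theorems file of route `LerayQuarterDissipation` (lead prover g16; `--supports` the crux; corollaries
of `…VorticityLThree` with the route's hardness bridge `…Hardness` and lead g15's
`…VorticityAmplitudeRegion`). Navier–Stokes regularity is NOT proved by anything here; no summit is.

The route's wall `Literature.Analysis.FluidPDE.TypeIDSSLiouville c` (Bradshaw–Tsai 2017 OP 5.1: a
backward `c`-DSS ancient mild solution with a Type-I envelope vanishes) is OPEN for factors away from
`1` and NECESSARY for the crux (`…Hardness`). A Type-I envelope `‖V(t,x)‖ ≤ C₀/(‖x‖ + √(−t))`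
yields the quarter-rate dissipation law (`Hardness.exists_dissipationLaw_of_hasTypeIDecay`), so the
stratum's `L³`-vorticity rung (`…VorticityLThree.eq_zero_of_vorticityLThree_lt`, valid for EVERY
dissipation constant) becomes a law-free statement:

* `eq_zero_of_typeI_envelope_of_vorticityLThree_lt` — **a Type-I ancient mild field in the KNSS
  gauge (any constant `C`) with a Type-I envelope whose vorticity obeys
  `√(−t)‖curl V(t)‖_{L³} ≤ v` (`∫⁻‖curl V(t)‖ₑ³ ≤ v³/(√(−t))³`) for all `t < 0`, `KS²v² < 3`,
  vanishes identically** — no self-similarity assumed;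
* `eq_zero_of_typeI_dss_of_vorticityLThree_lt` — in particular Bradshaw–Tsai OP 5.1 holds, for
  EVERY factor `c > 1`, on the sub-class `KS²·sup_t (−t)‖curl V(t)‖²_{L³} < 3` (recorded in the
  wall's quantifier shape, `IsDiscretelySelfSimilar c V`);
* `eq_zero_of_pastDss_of_vorticity_mul_dissipation_lt` — the DSS wall ON THE STRATUM under the
  hyperbola `KS⁶(C_ω‖curlCLM‖² max K 0)² < 27`, every factor (indeed every member there vanishes);
* `exists_gaps_not_singular_of_region₄` — bookkeeping: THE PROVED REGION of the crux in the four
  scale-invariant parameters `(C, K, C_ω, V₃)` = lead g14/g15's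
  `{C ≤ 1+ε(K)} ∪ {θ(K)⁴ ≤ 64/27+ε'(C)} ∪ {C_ω ≤ √3/4+ε''(C,K)} ∪ {joint (C,C_ω)}` ∪ (new)
  `{KS²V₃² < 3}` ∪ `{KS⁶(C_ω‖curlCLM‖² max K 0)² < 27}`.

HONEST FRAMING. Restrictions of the catalogued open problem / of the crux to explicit sub-classes;
the wall and the crux beyond these regions stay OPEN (FRONTIER); `KS` is Mathlib's non-sharp
Gagliardo–Nirenberg–Sobolev constant; nothing here bears on Navier–Stokes regularity or blow-up.

References: Bradshaw–Tsai, Comm. PDE 42 (2017) OP 5.1; Koch–Nadirashvili–Seregin–Šverák 2009 §4;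
Tsai, GSM 192, Conj. 8.8–8.9; folklore energy method.
-/

noncomputable section

set_option linter.dupNamespace false

namespace Summit.NavierStokesRegularity.NavierStokesRegularity.Theorems.FiniteDissipationLiouville.VorticityLThree

open MeasureTheory Set Filter Topology Metric Function
open scoped ENNReal
open Literature.Analysis Literature.Analysis.FluidPDE
open Summit.NavierStokesRegularity.NavierStokesRegularity.Theorems
open Summit.NavierStokesRegularity.NavierStokesRegularity.Theorems.FiniteDissipationLiouville

variable {C C₀ : ℝ} {V : ℝ → EuclideanSpace ℝ (Fin 3) → EuclideanSpace ℝ (Fin 3)}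

/-! ### Law-free forms: enveloped Type-I ancient fields -/

section LawFree

/-- **Enveloped Type-I ancient fields below the `L³`-vorticity threshold vanish** (no
self-similarity, no dissipation law assumed): a Type-I ancient mild field `V` (KNSS gauge, any
constant `C`) with a Type-I envelope `HasTypeIDecay C₀ V` and `∫⁻‖curl V(t)‖ₑ³ ≤ v³/(√(−t))³` for
all `t < 0` (`v ≥ 0`, `KS²v² < 3`) is identically zero on `t < 0` — the envelope gives the
quarter-rate law (`Hardness.exists_dissipationLaw_of_hasTypeIDecay`) and the rung
`eq_zero_of_vorticityLThree_lt` holds for every dissipation constant. [cite: KochNadirashviliSereginSverak2009, §4 (arXiv:0709.3599 p. 8)] -/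
theorem eq_zero_of_typeI_envelope_of_vorticityLThree_lt (hV : IsTypeIAncientMild C V)
    (hdec : HasTypeIDecay C₀ V) {v : ℝ} (hv0 : 0 ≤ v)
    (hv : (SNormLESNormFDerivOfEqConst (EuclideanSpace ℝ (Fin 3))
        (volume : Measure (EuclideanSpace ℝ (Fin 3))) 2 : ℝ) ^ 2 * v ^ 2 < 3)
    (hω : ∀ t : ℝ, t < 0 → ∫⁻ x, ‖curl (V t) x‖ₑ ^ 3 ≤ ENNReal.ofReal (v ^ 3 / Real.sqrt (-t) ^ 3)) :
    ∀ t < 0, ∀ x, V t x = 0 := by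
  obtain ⟨K', hlaw⟩ := Hardness.exists_dissipationLaw_of_hasTypeIDecay hV hdec
  exact eq_zero_of_vorticityLThree_lt hV hlaw hv0 hv hω

/-- **Bradshaw–Tsai OP 5.1 on the sub-class `KS²·V₃² < 3`, every factor** (recorded in the wall's
quantifier shape; the self-similarity is not even used): a Type-I ancient mild field with a Type-I
envelope, discretely self-similar with ANY factor `c > 1`, whose vorticity obeys
`∫⁻‖curl V(t)‖ₑ³ ≤ v³/(√(−t))³` with `KS²v² < 3`, vanishes identically on `t < 0`. [cite: KochNadirashviliSereginSverak2009, §4 (arXiv:0709.3599 p. 8)] -/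
theorem eq_zero_of_typeI_dss_of_vorticityLThree_lt (hV : IsTypeIAncientMild C V)
    (hdec : HasTypeIDecay C₀ V) {c : ℝ} (_hc : 1 < c) (_hdss : IsDiscretelySelfSimilar c V)
    {v : ℝ} (hv0 : 0 ≤ v)
    (hv : (SNormLESNormFDerivOfEqConst (EuclideanSpace ℝ (Fin 3))
        (volume : Measure (EuclideanSpace ℝ (Fin 3))) 2 : ℝ) ^ 2 * v ^ 2 < 3)
    (hω : ∀ t : ℝ, t < 0 → ∫⁻ x, ‖curl (V t) x‖ₑ ^ 3 ≤ ENNReal.ofReal (v ^ 3 / Real.sqrt (-t) ^ 3)) :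
    ∀ t < 0, ∀ x, V t x = 0 :=
  eq_zero_of_typeI_envelope_of_vorticityLThree_lt hV hdec hv0 hv hω

/-- **The DSS wall on the stratum under the `(K, C_ω)` hyperbola, every factor** (indeed every member
there vanishes, `eq_zero_of_vorticity_mul_dissipation_lt`; recorded in the wall's quantifier shape).
[folklore] -/
theorem eq_zero_of_pastDss_of_vorticity_mul_dissipation_lt (hV : IsTypeIAncientMild C V) {K : ℝ}
    (hlaw : ∀ s : ℝ, s < 0 → ∫⁻ x, ‖fderiv ℝ (V s) x‖ₑ ^ 2 ≤ ENNReal.ofReal (K / Real.sqrt (-s)))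
    {Cω : ℝ} (hω : ∀ t : ℝ, t < 0 → ∀ x, (-t) * ‖curl (V t) x‖ ≤ Cω)
    (hprod : (SNormLESNormFDerivOfEqConst (EuclideanSpace ℝ (Fin 3))
        (volume : Measure (EuclideanSpace ℝ (Fin 3))) 2 : ℝ) ^ 6 *
        (Cω * (‖curlCLM‖ ^ 2 * max K 0)) ^ 2 < 27)
    {c : ℝ} (_hc : 1 < c) (_hdss : ∀ t : ℝ, t < 0 → ∀ x, c • V (c ^ 2 * t) (c • x) = V t x) :
    ∀ t < 0, ∀ x, V t x = 0 :=
  eq_zero_of_vorticity_mul_dissipation_lt hV hlaw hω hprod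

end LawFree

/-! ### The proved region of the crux in `(C, K, C_ω, V₃)` -/

section Region

/-- **THE PROVED REGION OF `FiniteDissipationLiouville` IN THE FOUR PARAMETERS `(C, K, C_ω, V₃)`.**
For all `C, K` there are `ε, ε', ε'' > 0` such that every Type-I ancient mild `ū` (KNSS gauge,
constant `C`) obeying the quarter-rate law (constant `K`) with vorticity amplitude
`(−t)‖curl ū(t,x)‖ ≤ C_ω` and `L³`-vorticity law `∫⁻‖curl ū(t)‖ₑ³ ≤ v³/(√(−t))³` (`v ≥ 0`) that
lies in ONE of the regions `C ≤ 1 + ε`, `θ(K)⁴ ≤ 64/27 + ε'`, `C_ω ≤ √3/4 + ε''`, the joint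
`(C, C_ω)` region (lead g14/g15, `…VorticityAmplitudeRegion.exists_gaps_not_singular_of_region`), the
NEW `L³` region `KS²v² < 3`, or the NEW hyperbola `KS⁶(C_ω‖curlCLM‖² max K 0)² < 27`, is bounded on
a backward parabolic cylinder at the origin — the crux's conclusion. Beyond: FRONTIER (the catalogued
DSS wall ∪ wandering critical elements). [folklore] -/
theorem exists_gaps_not_singular_of_region₄ (C K : ℝ) : ∃ ε : ℝ, 0 < ε ∧ ∃ ε' : ℝ, 0 < ε' ∧
    ∃ ε'' : ℝ, 0 < ε'' ∧
    ∀ (ū : ℝ → EuclideanSpace ℝ (Fin 3) → EuclideanSpace ℝ (Fin 3)) (Cω v : ℝ),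
      IsTypeIAncientMild C ū →
      (∀ s : ℝ, s < 0 → ∫⁻ x, ‖fderiv ℝ (ū s) x‖ₑ ^ 2 ≤ ENNReal.ofReal (K / Real.sqrt (-s))) →
      (∀ t : ℝ, t < 0 → ∀ x, (-t) * ‖curl (ū t) x‖ ≤ Cω) →
      0 ≤ v →
      (∀ t : ℝ, t < 0 → ∫⁻ x, ‖curl (ū t) x‖ₑ ^ 3 ≤ ENNReal.ofReal (v ^ 3 / Real.sqrt (-t) ^ 3)) →
      (C ≤ 1 + ε ∨
        (Real.sqrt (max K 0) *
          Real.sqrt (SNormLESNormFDerivOfEqConst (EuclideanSpace ℝ (Fin 3))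
            (volume : Measure (EuclideanSpace ℝ (Fin 3))) 2 : ℝ) ^ 3) ^ 4 ≤ 64 / 27 + ε' ∨
        Cω ≤ Real.sqrt 3 / 4 + ε'' ∨
        (∃ lam : ℝ, 0 < lam ∧ lam ≤ 1 ∧ lam ^ 2 * C ^ 2 + (1 - lam) * (4 * Cω * Real.sqrt 3 / 3) < 1) ∨
        (SNormLESNormFDerivOfEqConst (EuclideanSpace ℝ (Fin 3))
            (volume : Measure (EuclideanSpace ℝ (Fin 3))) 2 : ℝ) ^ 2 * v ^ 2 < 3 ∨
        (SNormLESNormFDerivOfEqConst (EuclideanSpace ℝ (Fin 3))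
            (volume : Measure (EuclideanSpace ℝ (Fin 3))) 2 : ℝ) ^ 6 *
          (Cω * (‖curlCLM‖ ^ 2 * max K 0)) ^ 2 < 27) →
      ¬ (∀ r > 0, ∀ M : ℝ, ∃ t ∈ Set.Ioo (-(r ^ 2)) (0 : ℝ),
          ∃ x ∈ Metric.ball (0 : EuclideanSpace ℝ (Fin 3)) r, M < ‖ū t x‖) := by
  obtain ⟨ε, hε, ε', hε', ε'', hε'', hreg⟩ := VorticityAmplitude.exists_gaps_not_singular_of_region C K
  refine ⟨ε, hε, ε', hε', ε'', hε'', fun ū Cω v hū hlaw hω hv0 hω3 hcase => ?_⟩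
  rcases hcase with h1 | h2 | h3 | h4 | h5 | h6
  · exact hreg ū Cω hū hlaw hω (Or.inl h1)
  · exact hreg ū Cω hū hlaw hω (Or.inr (Or.inl h2))
  · exact hreg ū Cω hū hlaw hω (Or.inr (Or.inr (Or.inl h3)))
  · exact hreg ū Cω hū hlaw hω (Or.inr (Or.inr (Or.inr h4)))
  · exact not_singular_of_vorticityLThree_lt hū hlaw hv0 h5 hω3
  · intro hsing
    have h27 := vorticity_mul_dissipation_ge_of_singular hū hlaw hsing hω
    linarith

end Region

end Summit.NavierStokesRegularity.NavierStokesRegularity.Theorems.FiniteDissipationLiouville.VorticityLThree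

end
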